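import Literature.Computability.Complexity.CircuitComposition
import HarnessLib

/-!
# Adder blocks over `B₂`: full adder, pair splitting and the MDFA of Demenkov–Kojevnikov–Kulikov–Yaroslavtsev

Straight-line `B₂`-circuit realizations (`Literature.Computability.Complexity.CktSize`) of the
constant-size blocks from which linear-size circuits for symmetric functions are built
(carry-save counting), with their arithmetic specifications:

* `pairVal P v = u + v` — the value of a pair of bits `{u, v}` of equal weight given in the
  *encoding* `(P, v) = (u ⊕ v, v)` of Demenkov et al. (a pair is passed between blocks as
  `(u ⊕ v, v)` rather than `(u, v)`: "following computations need `u ⊕ v` rather than `u` —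
  that's why one Boolean addition can be saved");
* the full adder on a bit `r` and an encoded pair (`faS`, `faC`, 4 gates: `r + u + v = s + 2c`);
* splitting an encoded pair without a third bit (`spC`, 1 gate: `u + v = P + 2·(u ∧ v)`);
* the **MDFA** (modified double full adder): inputs a bit `x` and two encoded pairs, outputs the
  sum bit and the two carries as an ENCODED pair, `x + u₁ + v₁ + u₂ + v₂ = c + 2(a + b)`, in
  **8 gates** (`mdC`, `mdA = a ⊕ b`, `mdB = b`) — two chained full adders cost 10;
* generic plumbing: any binary Boolean operation is one `B₂` gate (`cktSize_bin`), and
  `CktSize.keep` runs a block while keeping all its inputs available.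

Sources: E. Demenkov, A. Kojevnikov, A. S. Kulikov, G. Yaroslavtsev, *New upper bounds on the
Boolean circuit complexity of symmetric functions*, Inform. Process. Lett. 110 (2010) 264–267
(the MDFA block and the `4.5n + o(n)` circuits for all symmetric functions); the explicit gate
formulas are eq. (1) of I. S. Sergeev, *Upper bounds for the formula size of the majority
function*, arXiv:1208.3874 (PDF p. 4: `c = x ⊕ (u₁⊕v₁) ⊕ (u₂⊕v₂)`,
`b = (x⊕v₁)(u₁⊕v₁) ⊕ v₁`, `a ⊕ b = ((x⊕v₁) ∨ (u₁⊕v₁)) ⊕ (x ⊕ (u₁⊕v₁) ⊕ v₂)·¬(u₂⊕v₂)`), with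
`b` rewritten as `((x⊕v₁) ∨ (u₁⊕v₁)) ⊕ (x ⊕ (u₁⊕v₁))` so that the whole block has 8 gates
(A. S. Kulikov, D. Pechenev, N. Slezkin, *SAT-based circuit local improvement*, MFCS 2022,
§3.1.1: "MDFA … of size 8, whose specification is `MDFA(x₁⊕x₂, x₂, x₃, x₄, x₄⊕x₅) = (b₀, a₁, a₁⊕b₁)`").
All specifications here are finite Boolean identities, proved by `decide`.
-/

namespace Literature.Computability.Complexity

open GateList

variable {ι κ : Type*}

/-! ### One-gate and plumbing lemmas -/

/-- Any binary Boolean operation, as a gate function of fan-in `2`. [folklore] -/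
def GateFn.bin (f : Bool → Bool → Bool) : GateFn := ⟨2, fun v => f (v 0) (v 1)⟩

/-- Binary operations are `B₂` gates. [folklore] -/
theorem bin_mem_B2 (f : Bool → Bool → Bool) : GateFn.bin f ∈ B2 := le_refl 2

/-- Applying any binary Boolean operation to two given wires costs one `B₂` gate. [folklore] -/
theorem cktSize_bin (f : Bool → Bool → Bool) (i j : ι) :
    CktSize B2 (fun (x : ι → Bool) (_ : Unit) => f (x i) (x j)) 1 :=
  (CktSize.gate (B := B2) (GateFn.bin f) (bin_mem_B2 f) ![i, j]).congr fun _ _ => rfl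

/-- Running a block while keeping all its inputs available costs nothing extra. [folklore] -/
theorem CktSize.keep {B : Set GateFn} {f : (ι → Bool) → κ → Bool} {s : ℕ} (h : CktSize B f s) :
    CktSize B (fun x => Sum.elim x (f x)) s := by
  simpa using (CktSize.id B).pair h

/-- Adding one binary gate on two available wires, keeping everything: `s + 1` gates. [folklore] -/
theorem CktSize.andThen {f : (ι → Bool) → κ → Bool} {s : ℕ} (h : CktSize B2 f s)
    (op : Bool → Bool → Bool) (i j : κ) :
    CktSize B2 (fun x => Sum.elim (f x) (fun (_ : Unit) => op (f x i) (f x j))) (s + 1) :=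
  h.comp (cktSize_bin op i j).keep

/-! ### Encoded pairs -/

/-- The value `u + v` of a pair of bits `{u, v}` presented in the encoding `(P, v) = (u ⊕ v, v)`
of Demenkov et al.: `1` if `P`, else `2v`. [cite: KulikovPechenevSlezkin2022, §3.1.1] -/
def pairVal (P v : Bool) : ℕ := P.toNat + 2 * (v && !P).toNat

/-- The encoding is faithful: `pairVal (u ⊕ v) v = u + v`. [cite: KulikovPechenevSlezkin2022, §3.1.1] -/
theorem pairVal_xor (u v : Bool) : pairVal (xor u v) v = u.toNat + v.toNat := by
  revert u v; decide

/-- An encoded pair is worth at most `2`. [folklore] -/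
theorem pairVal_le (P v : Bool) : pairVal P v ≤ 2 := by revert P v; decide

/-! ### Splitting a pair (half adder on an encoded pair) -/

/-- Carry of an encoded pair `{u, v}`: `u ∧ v = v ∧ ¬P`. Its sum bit is `P` itself (no gate). [folklore] -/
def spC (P v : Bool) : Bool := v && !P

/-- `u + v = P + 2 (u ∧ v)` for an encoded pair. [folklore] -/
theorem spC_spec (P v : Bool) : pairVal P v = P.toNat + 2 * (spC P v).toNat := rfl

/-! ### The full adder on a bit and an encoded pair -/

/-- Sum bit of the full adder `r + u + v` with `{u, v}` encoded as `(P, v)`: `r ⊕ P`. [folklore] -/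
def faS (r P : Bool) : Bool := xor r P

/-- Carry of the full adder `r + u + v` with `{u, v}` encoded as `(P, v)`:
`MAJ(r, u, v) = ((r ⊕ v) ∧ P) ⊕ v` (`= r` if `u ≠ v`, `= v` if `u = v`). [folklore] -/
def faC (r P v : Bool) : Bool := xor ((xor r v) && P) v

/-- Full-adder identity `r + (u + v) = s + 2c`. [folklore] -/
theorem fa_spec (r P v : Bool) :
    r.toNat + pairVal P v = (faS r P).toNat + 2 * (faC r P v).toNat := by
  revert r P v; decide

/-- The full adder on wires `r, P, v` costs `4` gates over `B₂`; outputs indexed by `Bool`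
(`false ↦` sum bit, `true ↦` carry). [folklore] -/
theorem cktSize_fa (r P v : ι) :
    CktSize B2 (fun (x : ι → Bool) (o : Bool) => cond o (faC (x r) (x P) (x v)) (faS (x r) (x P)))
      4 := by
  have h1 : CktSize B2 (fun (x : ι → Bool) => Sum.elim x (Sum.elim (fun (_ : Unit) => xor (x r) (x P))
      (fun (_ : Unit) => xor (x r) (x v)))) (0 + (1 + 1)) :=
    (CktSize.id B2).pair ((cktSize_bin xor r P).pair (cktSize_bin xor r v))
  have h2 := (h1.andThen (· && ·) (.inr (.inr ())) (.inl P)).andThen xor (.inr ()) (.inl (.inl v))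
  refine (h2.outMap fun o : Bool => cond o (.inr ()) (.inl (.inl (.inr (.inl ()))))).congr
    fun x o => ?_
  cases o <;> rfl

/-! ### The MDFA block -/

/-- MDFA sum bit: `c = x ⊕ P₁ ⊕ P₂`. [cite: KulikovPechenevSlezkin2022, §3.1.1] -/
def mdC (x P₁ P₂ : Bool) : Bool := xor (xor x P₁) P₂

/-- MDFA second carry component `b = ((x ⊕ v₁) ∨ P₁) ⊕ (x ⊕ P₁)` (the carry `MAJ(x, u₁, v₁)` of
the first full adder). [cite: KulikovPechenevSlezkin2022, §3.1.1] -/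
def mdB (x P₁ v₁ : Bool) : Bool := xor ((xor x v₁) || P₁) (xor x P₁)

/-- MDFA first carry component `a ⊕ b = ((x ⊕ v₁) ∨ P₁) ⊕ ((x ⊕ P₁ ⊕ v₂) ∧ ¬P₂)` — the XOR of
the two carries, i.e. the `P`-component of the ENCODED carry pair. [cite: KulikovPechenevSlezkin2022, §3.1.1] -/
def mdA (x P₁ v₁ P₂ v₂ : Bool) : Bool := xor ((xor x v₁) || P₁) ((xor (xor x P₁) v₂) && !P₂)

/-- **MDFA specification**: `x + (u₁ + v₁) + (u₂ + v₂) = c + 2 (a + b)`, the carry pair `{a, b}`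
being delivered encoded as `(a ⊕ b, b) = (mdA, mdB)`. [cite: KulikovPechenevSlezkin2022, §3.1.1] -/
theorem mdfa_spec (x P₁ v₁ P₂ v₂ : Bool) :
    x.toNat + pairVal P₁ v₁ + pairVal P₂ v₂ =
      (mdC x P₁ P₂).toNat + 2 * pairVal (mdA x P₁ v₁ P₂ v₂) (mdB x P₁ v₁) := by
  revert x P₁ v₁ P₂ v₂; decide

/-- Output selector of the MDFA block: `none ↦` sum bit, `some false ↦ a ⊕ b`, `some true ↦ b`. [folklore] -/
def mdOut (x P₁ v₁ P₂ v₂ : Bool) : Option Bool → Bool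
  | none => mdC x P₁ P₂
  | some false => mdA x P₁ v₁ P₂ v₂
  | some true => mdB x P₁ v₁

/-- **The MDFA has `8` gates** over `B₂` (Demenkov–Kojevnikov–Kulikov–Yaroslavtsev 2010; gate list:
`g₁ = x⊕v₁, s₁ = x⊕P₁, c = s₁⊕P₂, g₆ = g₁∨P₁, b = g₆⊕s₁, g₇ = s₁⊕v₂, g₈ = g₇∧¬P₂, a⊕b = g₆⊕g₈`). [cite: KulikovPechenevSlezkin2022, §3.1.1] -/
theorem cktSize_mdfa (x P₁ v₁ P₂ v₂ : ι) :
    CktSize B2 (fun (y : ι → Bool) => mdOut (y x) (y P₁) (y v₁) (y P₂) (y v₂)) 8 := by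
  -- layer 1: g₁ = x ⊕ v₁ and s₁ = x ⊕ P₁, keeping the inputs
  have h1 : CktSize B2 (fun (y : ι → Bool) => Sum.elim y (Sum.elim (fun (_ : Unit) => xor (y x) (y v₁))
      (fun (_ : Unit) => xor (y x) (y P₁)))) (0 + (1 + 1)) :=
    (CktSize.id B2).pair ((cktSize_bin xor x v₁).pair (cktSize_bin xor x P₁))
  -- then one gate at a time: c, g₆, b, g₇, g₈, a⊕b
  have h2 := (((((h1.andThen xor (.inr (.inr ())) (.inl P₂)).andThen (· || ·) (.inl (.inr (.inl ())))
    (.inl (.inl P₁))).andThen xor (.inr ()) (.inl (.inl (.inr (.inr ()))))).andThen xor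
    (.inl (.inl (.inl (.inr (.inr ()))))) (.inl (.inl (.inl (.inl v₂))))).andThen
    (fun g p => g && !p) (.inr ()) (.inl (.inl (.inl (.inl (.inl P₂)))))).andThen xor
    (.inl (.inl (.inl (.inr ())))) (.inr ())
  refine (h2.outMap fun o : Option Bool => match o with
    | none => .inl (.inl (.inl (.inl (.inl (.inr ())))))
    | some false => .inr ()
    | some true => .inl (.inl (.inl (.inr ())))).congr fun y o => ?_
  rcases o with _ | _ | _ <;> rfl

end Literature.Computability.Complexity
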